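import Summits.CriticalPhenomena.PercolationContinuityZ3.Theorems.Transplant.SkelFrmQuasiBParamsFaceFloorsLYA
import Summits.CriticalPhenomena.PercolationContinuityZ3.Theorems.Transplant.SkelFrmBParamsFaceFloorsLYA
import Summits.CriticalPhenomena.PercolationContinuityZ3.Theorems.Transplant.SkelFrmQuasiBParamsFaceFloorsZYA
import Summits.CriticalPhenomena.PercolationContinuityZ3.Theorems.Transplant.SkelFrmBParamsFaceFloorsZYA
import Summits.CriticalPhenomena.PercolationContinuityZ3.Theorems.Transplant.SkelFrmQuasiBParamsFaceCountsWY
import Summits.CriticalPhenomena.PercolationContinuityZ3.Theorems.Transplant.SkelFrmBParamsFaceCountsWY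
import Summits.CriticalPhenomena.PercolationContinuityZ3.Theorems.Transplant.SkelFrmQuasiBParamsFaceCountsRangeYA
import Summits.CriticalPhenomena.PercolationContinuityZ3.Theorems.Transplant.SkelFrmBParamsFaceCountsRangeYA
import Summits.CriticalPhenomena.PercolationContinuityZ3.Theorems.Transplant.SkelFrmQuasiBChoiceWindow3
import Summits.CriticalPhenomena.PercolationContinuityZ3.Theorems.Transplant.SkelFrmBChoiceWindow3
import Summits.CriticalPhenomena.PercolationContinuityZ3.Theorems.Transplant.PlanarSkeletonFrmQuasiDefs
import Summits.CriticalPhenomena.PercolationContinuityZ3.Theorems.Transplant.PlanarSkeletonFrmDefs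
import Summits.CriticalPhenomena.PercolationContinuityZ3.Theorems.Transplant.SkelPhiStepIDataNS
import Summits.CriticalPhenomena.PercolationContinuityZ3.Theorems.Transplant.SkelFrmQuasi1SlotTypes
import HarnessLib
import Summits.CriticalPhenomena.PercolationContinuityZ3.Theorems.Transplant.SkelFrmBParamsFaceFloorsY2WA
/-!
# GEN-Q PORT (WAVE-Q table v0.8 section 2, row G200, U-level L20; captain R-6/R-7 2026-08-27: carrier token swap `PlanarSkeletonFrmFrom ↦ PlanarSkeletonFrmQuasi`)
# of the tree module «Transplant/SkelFrmFromBParamsFaceFloorsY2WA» (sha256 192a6ac8c29a4ba0…) onto the quasi-step carrier `PlanarSkeletonFrmQuasi` (p507026): «SkelFrmQuasiBParamsFaceFloorsY2WA»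

HAND HUNK (L-FLOORMAP-1 ①⑥ / L-KitS-1 reader side; G017 «SkelFrmQuasiBChoiceNums», hp-8's KitSN): R'0×29 — the (S0) kit of record at window cost `KS.NQ Φ`.

ORIGINAL TITLE: N2 (frames-only node, OPEN) — (F) value layer under (R-44)(c): **THE ONE-SIDED y′-FACE FIELD LEMMAS** (hp-8 g43)

builds on p205010 (kernel theorem, internal audit signed; external expert review pending) — nothing in this file uses p205010; NOTHING is claimed about any open node
((N3-b), the end state).  Lane `prim-bschramm`, seat `prim-bschramm-stmt` (gen 33; GEN-Q column pen; tool = captain gen-1 g4's port_genq.py R-14 --cone + p3-g30's T1 patch).  Helper file (`--supports stmt-CriticalPhenomena-4575 --as helper`).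
PORT RULES (U-wave r1–r4 re-used, GEN-Q hunk classes of p3-g29 #6136): declaration order, names and proof texts are those of «SkelFrmFromBParamsFaceFloorsY2WA», byte-identical except
(i) the carrier token `PlanarSkeletonFrmFrom ↦ PlanarSkeletonFrmQuasi` in binders, `namespace`/`end` lines and qualified names (module names `SkelFrmFrom… ↦ SkelFrmQuasi…`
in imports of already-ported rows); (ii) `Φ.step ↦ Φ.qstep` with the called Steps lemma replaced by its `…Q`/`_q` twin and the cost `Φ.M` threaded (none in this file unless
listed below); (iii) `Φ.cyl_connected ↦ Φ.cyl_reach` readers (none unless listed); (iv) graph-ball radii / window floors ×`Φ.M` (none unless listed).  Carrier-free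
residents stay imported/exported from the original «SkelFrmBParamsFaceFloorsY2WA» exactly as in the FrmFrom port.  Docstrings and citations are the original's.

-/

noncomputable section

open scoped Classical

namespace Summit.CriticalPhenomena.PercolationContinuityZ3.Theorems.Transplant

namespace PlanarSkeletonFrmQuasi

namespace NegB

open Literature.Probability.Percolation Literature.Probability.LatticeModels SimpleGraph
open Literature.Probability.Percolation.KozmaNitzan.Cells (oth sgOf sgOf_sign)
open SkelConc (Consts)
open Skelφ (shearUnit shearUnit_pos crossOffY xCSLo xCSHi xCoreB)
open Skelφ.StepI (DataN)
open TwoAxis.Para (modulus)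
open Neg

namespace KS

export PlanarSkeletonNeg.NegB.KS (xCS_eval)

/-! ## §1 The one-sided window tolerance and the count's range -/

section Window

/-- **The one-sided landing tolerance of the y′-face tangential x-run**: `bwY := small3 0 − 7·s₀` (the window of record minus the last x-core's
budget `7u₀` of `lastCore_room₀W`). [this work] -/
def bwY (κ : Consts) {V : Type} [DecidableEq V] [Countable V] {G : SimpleGraph V} [G.LocallyFinite] (Φ : PlanarSkeletonFrmQuasi G) (t : V) (p : unitInterval) (D : Skelφ.StepI.DataNS V) (g f : ℕ) : ℕ :=
  NegB.BSlot.small3 κ Φ t p D g f 0 - 7 * (fcellsA κ Φ t p D g f).s 0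

/-- `bwY = small3 0 − 7·u₀A` in `ℤ`, and `u₀A ≤ 2·bwY` (any window `≥ 8·s₀` serves). [folklore] -/
theorem bwY_eq (κ : Consts) {V : Type} [DecidableEq V] [Countable V] {G : SimpleGraph V} [G.LocallyFinite] (Φ : PlanarSkeletonFrmQuasi G) (t : V) (p : unitInterval) (D : Skelφ.StepI.DataNS V) (g f : ℕ) :
    ((bwY κ Φ t p D g f : ℕ) : ℤ) = ((NegB.BSlot.small3 κ Φ t p D g f 0 : ℕ) : ℤ) - 7 * u₀A κ Φ t p D g f ∧ u₀A κ Φ t p D g f ≤ 2 * ((bwY κ Φ t p D g f : ℕ) : ℤ) := by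
  have h7 : 7 * (fcellsA κ Φ t p D g f).s 0 ≤ NegB.BSlot.small3 κ Φ t p D g f 0 := by rw [(NegB.small3_eq κ Φ t p D g f).1]; omega
  have h15 : 15 * (fcellsA κ Φ t p D g f).s 0 ≤ 2 * NegB.BSlot.small3 κ Φ t p D g f 0 := by rw [(NegB.small3_eq κ Φ t p D g f).1]; omega
  unfold bwY u₀A
  refine ⟨by push_cast [Nat.cast_sub h7]; ring, ?_⟩
  have : (((fcellsA κ Φ t p D g f).s 0 : ℕ) : ℤ) ≤ 2 * (((NegB.BSlot.small3 κ Φ t p D g f 0 - 7 * (fcellsA κ Φ t p D g f).s 0 : ℕ) : ℤ)) := by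
    push_cast [Nat.cast_sub h7]
    have := (Int.ofNat_le).2 h15; push_cast at this; linarith
  simpa using this

/-- (R-44)(c) ONE-SIDED TWIN (hp-8 g43) of **THE TANGENTIAL COUNT OF THE x-RUN IS IN RANGE**: `N3Y + 1 ≤ 200·Kq + 10` whenever the contact's transverse offset is within the band
`kE ≤ 5r₀` and the landing origin's abscissa reading within eight strides. [folklore] -/
theorem N3WY_range (κ : Consts) {V : Type} [DecidableEq V] [Countable V] {G : SimpleGraph V} [G.LocallyFinite] (Φ : PlanarSkeletonFrmQuasi G) (t : V) (p : unitInterval) (D : Skelφ.StepI.DataNS V) (g : ℕ) (f : ℕ) (P : PCells2T) (hP : P.toPCells2 = fcellsA κ Φ t p D g f) (yL x : Site 2) (du : MDir) (hd : du.1 = 1) (z : Site 2) {kE C₀ : ℤ} (hz : |z 0 - P.cenS x 0| ≤ kE)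
    (hkE : kE ≤ 5 * (P.r 0 : ℤ)) (hC0 : |FcA κ Φ t p D g f yL| ≤ C₀) (hC0' : C₀ ≤ 8 * u₀A κ Φ t p D g f)
    {bw : ℕ} (hbw : u₀A κ Φ t p D g f ≤ 2 * (bw : ℤ)) (hF : FcA κ Φ t p D g f yL + u₀A κ Φ t p D g f ≤ T0Y P x du z + bw) :
    N3WY κ Φ t p D g f P yL x du z bw + 1 ≤ 240 * Neg.Kq κ + 10 := by
  obtain ⟨r2, -, -⟩ := N3WY_spec κ Φ t p D g f P yL x du z hbw hF
  have hu : 1 ≤ u₀A κ Φ t p D g f := (units_eqA κ Φ t p D g f).2.2.2.2.1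
  have hr : (P.r 0 : ℤ) = 40 * (Neg.Kq κ : ℤ) * u₀A κ Φ t p D g f := by rw [(cells_of_hP κ Φ t p D g f P hP).1 0]; exact (units_eqA κ Φ t p D g f).2.2.1
  set u := u₀A κ Φ t p D g f
  set Q := (Neg.Kq κ : ℤ)
  have hc0 : 0 ≤ P.c 1 := P.hc0 1
  have hc1 : P.c 1 ≤ (P.r 0 : ℤ) := by have h := P.hcr 1; rwa [show oth (1 : Fin 2) = 0 from rfl] at h
  have hstep := cenS_step_zero P x du hd
  have hσ : |sgOf du * P.c 1| ≤ (P.r 0 : ℤ) := by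
    rcases sgOf_sign du with h | h <;> rw [h] <;> simp [abs_le] <;> constructor <;> linarith
  have hT : |T0Y P x du z - FcA κ Φ t p D g f yL| ≤ kE + (P.r 0 : ℤ) + C₀ := by
    unfold T0Y
    rw [hstep]
    calc |P.cenS x 0 + sgOf du * P.c 1 - z 0 - FcA κ Φ t p D g f yL|
        = |-(z 0 - P.cenS x 0) + sgOf du * P.c 1 + -FcA κ Φ t p D g f yL| := by ring_nf
      _ ≤ |-(z 0 - P.cenS x 0) + sgOf du * P.c 1| + |-FcA κ Φ t p D g f yL| := abs_add_le _ _
      _ ≤ |-(z 0 - P.cenS x 0)| + |sgOf du * P.c 1| + |-FcA κ Φ t p D g f yL| := by linarith [abs_add_le (-(z 0 - P.cenS x 0)) (sgOf du * P.c 1)]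
      _ ≤ kE + (P.r 0 : ℤ) + C₀ := by rw [abs_neg, abs_neg]; linarith
  have h1 : u * ((N3WY κ Φ t p D g f P yL x du z bw : ℤ) + 1) ≤ u * (240 * Q + 10) := by nlinarith
  have h2 : ((N3WY κ Φ t p D g f P yL x du z bw : ℤ) + 1) ≤ 240 * Q + 10 := le_of_mul_le_mul_left h1 (by linarith)
  have h3 : ((N3WY κ Φ t p D g f P yL x du z bw + 1 : ℕ) : ℤ) ≤ ((240 * Neg.Kq κ + 10 : ℕ) : ℤ) := by push_cast; exact h2
  exact_mod_cast h3

end Window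

/-! ## §2 The tight last-core budget and the transverse landing rows at the window of record -/

section Landing

/-- **The TIGHT α-budget of the last core** ((R-44)(c), hp-8 g43; the T lemma `lastCore_room₀` proves this and then spends the whole window):
`u₀·m·(q + kR′) + u₀·n·U·(xCoreB + 1) + u₀·n ≤ n·m·(7u₀ − 3)` under `q + kR′ ≤ 3n_L`,
`11(kR′ + 4) ≤ ℓ_L`, `6RA′ + 11 ≤ u₀`. [folklore] -/
theorem lastCore_room₀W (κ : Consts) {V : Type} [DecidableEq V] [Countable V] {G : SimpleGraph V} [G.LocallyFinite] (Φ : PlanarSkeletonFrmQuasi G) (t : V) (p : unitInterval) (D : Skelφ.StepI.DataNS V) (mk : ℕ) (g : ℕ) (f : ℕ) (hN : EqNumL κ Φ t p D g f) (hκ : (hL κ Φ t p D g f).natAbs ≤ 10 * nL κ Φ t p D g f) {q k : ℕ}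
    (hq3 : (q : ℤ) + (k : ℤ) * (KS0.R'0N κ Φ (KS.NQ Φ) t p D mk : ℤ) ≤ 3 * ((nL κ Φ t p D g f) : ℤ)) (hℓk : 11 * ((k : ℤ) * (KS0.R'0N κ Φ (KS.NQ Φ) t p D mk : ℤ) + 4) ≤ ((ℓL κ Φ t p D g f) : ℤ))
    (hs0 : 6 * (KS0.R'0N κ Φ (KS.NQ Φ) t p D mk : ℤ) + 11 ≤ u₀A κ Φ t p D g f) :
    u₀A κ Φ t p D g f * (modulus (nL κ Φ t p D g f) (hL κ Φ t p D g f) (vL κ Φ t p D g f) (vβL κ Φ t p D g f)) * ((q : ℤ) + (k : ℤ) * (KS0.R'0N κ Φ (KS.NQ Φ) t p D mk : ℤ)) + u₀A κ Φ t p D g f * ((nL κ Φ t p D g f) : ℤ) * ((shearUnit (nL κ Φ t p D g f) (hL κ Φ t p D g f) : ℤ) * (xCoreB (nL κ Φ t p D g f) (ℓL κ Φ t p D g f) (hL κ Φ t p D g f) (KS0.R'0N κ Φ (KS.NQ Φ) t p D mk) k + 1)) +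
        u₀A κ Φ t p D g f * ((nL κ Φ t p D g f) : ℤ) ≤ ((nL κ Φ t p D g f) : ℤ) * (modulus (nL κ Φ t p D g f) (hL κ Φ t p D g f) (vL κ Φ t p D g f) (vβL κ Φ t p D g f)) * (7 * u₀A κ Φ t p D g f - 3) := by
  obtain ⟨hn1, hℓ1⟩ := one_le_of_eqNumL κ Φ t p D g f hN
  obtain ⟨hU1, hU2⟩ := clr_shearUnit_bounds κ Φ t p D g f hκ
  obtain ⟨hmlo, -⟩ := modulus_top κ Φ t p D g f hn1
  obtain ⟨-, henv⟩ := xCoreB_env κ Φ t p D g f hN hκ (KS0.R'0N κ Φ (KS.NQ Φ) t p D mk) k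
  have hm0 : 0 < (modulus (nL κ Φ t p D g f) (hL κ Φ t p D g f) (vL κ Φ t p D g f) (vβL κ Φ t p D g f)) := Skelφ.NegPrm.modulus_vβOf_pos hn1 hℓ1 _ _
  have hq1 : (1 : ℤ) ≤ Neg.Kq κ := by exact_mod_cast Neg.one_le_Kq κ
  have hR0 : (0 : ℤ) ≤ (KS0.R'0N κ Φ (KS.NQ Φ) t p D mk : ℤ) := Nat.cast_nonneg _
  have hn : (1 : ℤ) ≤ ((nL κ Φ t p D g f) : ℤ) := by exact_mod_cast hn1
  set n : ℤ := ((nL κ Φ t p D g f) : ℤ)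
  set m : ℤ := (modulus (nL κ Φ t p D g f) (hL κ Φ t p D g f) (vL κ Φ t p D g f) (vβL κ Φ t p D g f))
  set u : ℤ := u₀A κ Φ t p D g f
  set Uz : ℤ := (shearUnit (nL κ Φ t p D g f) (hL κ Φ t p D g f) : ℤ)
  set X : ℤ := xCoreB (nL κ Φ t p D g f) (ℓL κ Φ t p D g f) (hL κ Φ t p D g f) (KS0.R'0N κ Φ (KS.NQ Φ) t p D mk) k
  set kR : ℤ := (k : ℤ) * (KS0.R'0N κ Φ (KS.NQ Φ) t p D mk : ℤ)
  have hu0 : 0 ≤ u := by linarith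
  have hkR0 : 0 ≤ kR := by positivity
  -- `m ≥ n(ℓ − 11) + 1`
  have hml : n * (((ℓL κ Φ t p D g f) : ℤ) - 11) + 1 ≤ m := by nlinarith
  -- the three pieces
  have h1 : u * m * ((q : ℤ) + kR) ≤ 3 * (u * n * m) := by
    have := mul_le_mul_of_nonneg_left hq3 (mul_nonneg hu0 hm0.le); linarith
  have h2 : u * n * (Uz * (X + 1)) ≤ u * n * m + 11 * (u * n * n) * (kR + 3) := by
    have := mul_le_mul_of_nonneg_left henv (mul_nonneg hu0 (by linarith : (0:ℤ) ≤ n)); linarith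
  -- `11 n (kR + 3) + 1 ≤ 2 (n (ℓ − 11) + 1) ≤ 2m` and `2u ≤ 3u − 3`
  have h3 : 11 * n * (kR + 3) + 1 ≤ 2 * m := by nlinarith
  have h4 : 11 * (u * n * n) * (kR + 3) + u * n ≤ n * m * (3 * u - 3) := by
    have a : u * (11 * n * (kR + 3) + 1) ≤ u * (2 * m) := mul_le_mul_of_nonneg_left h3 hu0
    have b : u * (2 * m) ≤ m * (3 * u - 3) := by nlinarith
    have c : n * (u * (11 * n * (kR + 3) + 1)) ≤ n * (m * (3 * u - 3)) := mul_le_mul_of_nonneg_left (a.trans b) (by linarith)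
    linarith
  nlinarith

/-- **`FL1` (y′-face) ONE-SIDED**: the last core's lower transverse (axis-0) reading is inside the arrival box of half-width `small3 0`, given the
window landing `T0Y − bwY ≤ FcA yT + u₀·k`. [cite: KozmaNitzan2024, §4 Lemma 12 (pp. 23–25)] -/
theorem FL1_YW (κ : Consts) {V : Type} [DecidableEq V] [Countable V] {G : SimpleGraph V} [G.LocallyFinite] (Φ : PlanarSkeletonFrmQuasi G) (t : V) (p : unitInterval) (D : Skelφ.StepI.DataNS V) (mk : ℕ) (g : ℕ) (f : ℕ) (P : PCells2T) (hP : P.toPCells2 = fcellsA κ Φ t p D g f) (hN : EqNumL κ Φ t p D g f) (hκ : (hL κ Φ t p D g f).natAbs ≤ 10 * nL κ Φ t p D g f) (x : Site 2) (du : MDir) (z : Site 2)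
    (yT : Site 2) {q k : ℕ}
    (hlo : T0Y P x du z - bwY κ Φ t p D g f ≤ FcA κ Φ t p D g f yT + 1 * u₀A κ Φ t p D g f * (k : ℤ))
    (hq3 : (q : ℤ) + (k : ℤ) * (KS0.R'0N κ Φ (KS.NQ Φ) t p D mk : ℤ) ≤ 3 * ((nL κ Φ t p D g f) : ℤ)) (hℓk : 11 * ((k : ℤ) * (KS0.R'0N κ Φ (KS.NQ Φ) t p D mk : ℤ) + 4) ≤ ((ℓL κ Φ t p D g f) : ℤ)) (hs0 : 6 * (KS0.R'0N κ Φ (KS.NQ Φ) t p D mk : ℤ) + 11 ≤ u₀A κ Φ t p D g f) :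
    ((nL κ Φ t p D g f) : ℤ) * (modulus (nL κ Φ t p D g f) (hL κ Φ t p D g f) (vL κ Φ t p D g f) (vβL κ Φ t p D g f)) * (P.cenS (x + stepVec du) 0 - ((NegB.BSlot.small3 κ Φ t p D g f 0 : ℕ) : ℤ) + 2 - z 0 - FcA κ Φ t p D g f yT) ≤
      (((P.s 0 : ℕ) : ℤ)) * (modulus (nL κ Φ t p D g f) (hL κ Φ t p D g f) (vL κ Φ t p D g f) (vβL κ Φ t p D g f)) * xCSLo (nL κ Φ t p D g f) q (KS0.R'0N κ Φ (KS.NQ Φ) t p D mk) 1 k -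
        (((P.s 0 : ℕ) : ℤ)) * (((nL κ Φ t p D g f) : ℕ) : ℤ) * (shearUnit (nL κ Φ t p D g f) (hL κ Φ t p D g f) : ℤ) * (xCoreB (nL κ Φ t p D g f) (ℓL κ Φ t p D g f) (hL κ Φ t p D g f) (KS0.R'0N κ Φ (KS.NQ Φ) t p D mk) k + 1) -
        (((P.s 0 : ℕ) : ℤ)) * ((nL κ Φ t p D g f) : ℤ) - ((nL κ Φ t p D g f) : ℤ) * (modulus (nL κ Φ t p D g f) (hL κ Φ t p D g f) (vL κ Φ t p D g f) (vβL κ Φ t p D g f)) := by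
  obtain ⟨hn1, hℓ1⟩ := one_le_of_eqNumL κ Φ t p D g f hN
  have hm0 : 0 < (modulus (nL κ Φ t p D g f) (hL κ Φ t p D g f) (vL κ Φ t p D g f) (vβL κ Φ t p D g f)) := Skelφ.NegPrm.modulus_vβOf_pos hn1 hℓ1 _ _
  obtain ⟨hlo', -⟩ := xCS_eval (nL κ Φ t p D g f) q (KS0.R'0N κ Φ (KS.NQ Φ) t p D mk) (Or.inl rfl : (1 : ℤ) = 1 ∨ (1 : ℤ) = -1) k
  have hroom := lastCore_room₀W κ Φ t p D mk g f hN hκ hq3 hℓk hs0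
  have es : (((P.s 0 : ℕ) : ℤ)) = u₀A κ Φ t p D g f := by rw [(cells_of_hP κ Φ t p D g f P hP).2.1 0]; rfl
  have hbw := (bwY_eq κ Φ t p D g f).1
  have hT : P.cenS (x + stepVec du) 0 - z 0 = T0Y P x du z := rfl
  have hn : (1 : ℤ) ≤ ((nL κ Φ t p D g f) : ℤ) := by exact_mod_cast hn1
  rw [es, hlo']
  rw [hbw] at hlo
  set m : ℤ := (modulus (nL κ Φ t p D g f) (hL κ Φ t p D g f) (vL κ Φ t p D g f) (vβL κ Φ t p D g f))
  set u : ℤ := u₀A κ Φ t p D g f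
  set n : ℤ := ((nL κ Φ t p D g f) : ℤ)
  set Uz : ℤ := (shearUnit (nL κ Φ t p D g f) (hL κ Φ t p D g f) : ℤ)
  set X : ℤ := xCoreB (nL κ Φ t p D g f) (ℓL κ Φ t p D g f) (hL κ Φ t p D g f) (KS0.R'0N κ Φ (KS.NQ Φ) t p D mk) k
  set F0 := FcA κ Φ t p D g f yT
  set T0 := T0Y P x du z
  set kR : ℤ := (k : ℤ) * (KS0.R'0N κ Φ (KS.NQ Φ) t p D mk : ℤ)
  set b₂ : ℤ := ((NegB.BSlot.small3 κ Φ t p D g f 0 : ℕ) : ℤ)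
  have hu0 : 0 ≤ u := by linarith [(Nat.cast_nonneg (KS0.R'0N κ Φ (KS.NQ Φ) t p D mk) : (0:ℤ) ≤ (KS0.R'0N κ Φ (KS.NQ Φ) t p D mk : ℤ))]
  have hL : n * m * (P.cenS (x + stepVec du) 0 - b₂ + 2 - z 0 - F0) ≤ n * m * (1 * u * (k : ℤ)) - n * m * (7 * u - 2) := by
    have h : (P.cenS (x + stepVec du) 0 - z 0) - b₂ + 2 - F0 ≤ 1 * u * (k : ℤ) - (7 * u - 2) := by rw [hT]; linarith
    have := mul_le_mul_of_nonneg_left h (mul_nonneg (by linarith : (0:ℤ) ≤ n) hm0.le)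
    nlinarith
  have e1 : u * m * (1 * ((k : ℤ) * n) - ((q : ℤ) + kR)) = n * m * (1 * u * (k : ℤ)) - u * m * ((q : ℤ) + kR) := by ring
  rw [e1]
  have e2 : u * n * Uz * (X + 1) = u * n * (Uz * (X + 1)) := by ring
  rw [e2]
  nlinarith

/-- **`FL2` (y′-face) ONE-SIDED**: the last core's upper transverse (axis-0) reading is inside the arrival box of half-width `small3 0`, given the
window landing `FcA yT + u₀·k ≤ T0Y + bwY`. [cite: KozmaNitzan2024, §4 Lemma 12 (pp. 23–25)] -/
theorem FL2_YW (κ : Consts) {V : Type} [DecidableEq V] [Countable V] {G : SimpleGraph V} [G.LocallyFinite] (Φ : PlanarSkeletonFrmQuasi G) (t : V) (p : unitInterval) (D : Skelφ.StepI.DataNS V) (mk : ℕ) (g : ℕ) (f : ℕ) (P : PCells2T) (hP : P.toPCells2 = fcellsA κ Φ t p D g f) (hN : EqNumL κ Φ t p D g f) (hκ : (hL κ Φ t p D g f).natAbs ≤ 10 * nL κ Φ t p D g f) (x : Site 2) (du : MDir) (z : Site 2)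
    (yT : Site 2) {q k : ℕ}
    (hhi : FcA κ Φ t p D g f yT + 1 * u₀A κ Φ t p D g f * (k : ℤ) ≤ T0Y P x du z + bwY κ Φ t p D g f)
    (hq3 : (q : ℤ) + (k : ℤ) * (KS0.R'0N κ Φ (KS.NQ Φ) t p D mk : ℤ) ≤ 3 * ((nL κ Φ t p D g f) : ℤ)) (hℓk : 11 * ((k : ℤ) * (KS0.R'0N κ Φ (KS.NQ Φ) t p D mk : ℤ) + 4) ≤ ((ℓL κ Φ t p D g f) : ℤ)) (hs0 : 6 * (KS0.R'0N κ Φ (KS.NQ Φ) t p D mk : ℤ) + 11 ≤ u₀A κ Φ t p D g f) :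
    ((nL κ Φ t p D g f) : ℤ) * (modulus (nL κ Φ t p D g f) (hL κ Φ t p D g f) (vL κ Φ t p D g f) (vβL κ Φ t p D g f)) * (FcA κ Φ t p D g f yT + 1) + (((P.s 0 : ℕ) : ℤ)) * (modulus (nL κ Φ t p D g f) (hL κ Φ t p D g f) (vL κ Φ t p D g f) (vβL κ Φ t p D g f)) * xCSHi (nL κ Φ t p D g f) q (KS0.R'0N κ Φ (KS.NQ Φ) t p D mk) 1 k +
        (((P.s 0 : ℕ) : ℤ)) * (((nL κ Φ t p D g f) : ℕ) : ℤ) * (shearUnit (nL κ Φ t p D g f) (hL κ Φ t p D g f) : ℤ) * (xCoreB (nL κ Φ t p D g f) (ℓL κ Φ t p D g f) (hL κ Φ t p D g f) (KS0.R'0N κ Φ (KS.NQ Φ) t p D mk) k + 1) ≤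
      ((nL κ Φ t p D g f) : ℤ) * (modulus (nL κ Φ t p D g f) (hL κ Φ t p D g f) (vL κ Φ t p D g f) (vβL κ Φ t p D g f)) * (P.cenS (x + stepVec du) 0 + ((NegB.BSlot.small3 κ Φ t p D g f 0 : ℕ) : ℤ) - 2 - z 0) := by
  obtain ⟨hn1, hℓ1⟩ := one_le_of_eqNumL κ Φ t p D g f hN
  have hm0 : 0 < (modulus (nL κ Φ t p D g f) (hL κ Φ t p D g f) (vL κ Φ t p D g f) (vβL κ Φ t p D g f)) := Skelφ.NegPrm.modulus_vβOf_pos hn1 hℓ1 _ _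
  obtain ⟨-, hhi'⟩ := xCS_eval (nL κ Φ t p D g f) q (KS0.R'0N κ Φ (KS.NQ Φ) t p D mk) (Or.inl rfl : (1 : ℤ) = 1 ∨ (1 : ℤ) = -1) k
  have hroom := lastCore_room₀W κ Φ t p D mk g f hN hκ hq3 hℓk hs0
  have es : (((P.s 0 : ℕ) : ℤ)) = u₀A κ Φ t p D g f := by rw [(cells_of_hP κ Φ t p D g f P hP).2.1 0]; rfl
  have hbw := (bwY_eq κ Φ t p D g f).1
  have hT : P.cenS (x + stepVec du) 0 - z 0 = T0Y P x du z := rfl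
  have hn : (1 : ℤ) ≤ ((nL κ Φ t p D g f) : ℤ) := by exact_mod_cast hn1
  rw [es, hhi']
  rw [hbw] at hhi
  set m : ℤ := (modulus (nL κ Φ t p D g f) (hL κ Φ t p D g f) (vL κ Φ t p D g f) (vβL κ Φ t p D g f))
  set u : ℤ := u₀A κ Φ t p D g f
  set n : ℤ := ((nL κ Φ t p D g f) : ℤ)
  set Uz : ℤ := (shearUnit (nL κ Φ t p D g f) (hL κ Φ t p D g f) : ℤ)
  set X : ℤ := xCoreB (nL κ Φ t p D g f) (ℓL κ Φ t p D g f) (hL κ Φ t p D g f) (KS0.R'0N κ Φ (KS.NQ Φ) t p D mk) k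
  set F0 := FcA κ Φ t p D g f yT
  set T0 := T0Y P x du z
  set kR : ℤ := (k : ℤ) * (KS0.R'0N κ Φ (KS.NQ Φ) t p D mk : ℤ)
  set b₂ : ℤ := ((NegB.BSlot.small3 κ Φ t p D g f 0 : ℕ) : ℤ)
  have hu0 : 0 ≤ u := by linarith [(Nat.cast_nonneg (KS0.R'0N κ Φ (KS.NQ Φ) t p D mk) : (0:ℤ) ≤ (KS0.R'0N κ Φ (KS.NQ Φ) t p D mk : ℤ))]
  have hL : n * m * (F0 + 1) + n * m * (1 * u * (k : ℤ)) ≤ n * m * (P.cenS (x + stepVec du) 0 + b₂ - 2 - z 0) - n * m * (7 * u - 3) := by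
    have h : F0 + 1 + 1 * u * (k : ℤ) + (7 * u - 3) ≤ (P.cenS (x + stepVec du) 0 - z 0) + b₂ - 2 := by rw [hT]; linarith
    have := mul_le_mul_of_nonneg_left h (mul_nonneg (by linarith : (0:ℤ) ≤ n) hm0.le)
    nlinarith
  have e1 : u * m * (1 * ((k : ℤ) * n) + ((q : ℤ) + kR)) = n * m * (1 * u * (k : ℤ)) + u * m * ((q : ℤ) + kR) := by ring
  rw [e1]
  have e2 : u * n * Uz * (X + 1) = u * n * (Uz * (X + 1)) := by ring
  rw [e2]
  nlinarith

end Landing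

/-! ## §3 The forward run's positions and the far-zone row at the window of record -/

section Tan

/-- **The forward tangential x-run's positions stay inside the transverse room** (one-sided twin of `tanY_pos_YA`, count at the tangential origin
`yT`): for `k ≤ N3WY … yT …`, `FcA yT + u₀·k` lies between `−(5r₀ − 7 − c₁ − |z₀ − cen₀|) + 10u₀ + 2` and `5r₀ − 7 − c₁ − |z₀ − cen₀| − 10u₀ − 2`
(`|FcA yT| ≤ 6u₀`, `2kE + 24u₀ + 24 + 2c₁ ≤ 5r₀`; `mul_fwdCount_lt`). [folklore] -/
theorem tanY_pos_YW (κ : Consts) {V : Type} [DecidableEq V] [Countable V] {G : SimpleGraph V} [G.LocallyFinite] (Φ : PlanarSkeletonFrmQuasi G) (t : V) (p : unitInterval) (D : Skelφ.StepI.DataNS V) (g : ℕ) (f : ℕ) (P : PCells2T) (x : Site 2) (du : MDir) (hd : du.1 = 1) (z yT : Site 2) {kE : ℤ} (hz : |z 0 - P.cenS x 0| ≤ kE)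
    (hkE24 : 2 * kE + 24 * u₀A κ Φ t p D g f + 24 + 2 * (P.c 1 : ℤ) ≤ 5 * (P.r 0 : ℤ)) (hu : 1 ≤ u₀A κ Φ t p D g f)
    (he : |FcA κ Φ t p D g f yT| ≤ 6 * u₀A κ Φ t p D g f) (bw : ℕ) :
    ∀ k ≤ N3WY κ Φ t p D g f P yT x du z bw,
      -(5 * (P.r 0 : ℤ) - 4 - 3 - P.c 1 - |z 0 - P.cenS x 0|) + 10 * u₀A κ Φ t p D g f + 2 ≤
          FcA κ Φ t p D g f yT + 1 * u₀A κ Φ t p D g f * (k : ℤ) ∧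
        FcA κ Φ t p D g f yT + 1 * u₀A κ Φ t p D g f * (k : ℤ) + 10 * u₀A κ Φ t p D g f + 2 ≤
          5 * (P.r 0 : ℤ) - 4 - 3 - P.c 1 - |z 0 - P.cenS x 0| := by
  intro k hk
  set u := u₀A κ Φ t p D g f with hu_def
  have hun : ((u.toNat : ℕ) : ℤ) = u := Int.toNat_of_nonneg (by linarith)
  have hu0 : 0 < u.toNat := by omega
  have up := Skelφ.mul_fwdCount_lt (T := T0Y P x du z) (F := FcA κ Φ t p D g f yT + u) (bw := bw) hu0
  rw [hun] at up
  have hN : (N3WY κ Φ t p D g f P yT x du z bw : ℤ) = (Skelφ.fwdCount (T0Y P x du z) (FcA κ Φ t p D g f yT + u) u.toNat bw : ℤ) := rfl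
  have hk' : (k : ℤ) ≤ (N3WY κ Φ t p D g f P yT x du z bw : ℤ) := by exact_mod_cast hk
  rw [hN] at hk'
  have hc0 : (0 : ℤ) ≤ P.c 1 := P.c_nonneg 1
  have hσ1 : |sgOf du| = 1 := by rcases sgOf_sign du with h | h <;> simp [h]
  have hTle' : |T0Y P x du z| ≤ |z 0 - P.cenS x 0| + P.c 1 := by
    have e : T0Y P x du z = -(z 0 - P.cenS x 0) + sgOf du * P.c 1 := by unfold T0Y; rw [cenS_step_zero P x du hd]; ring
    rw [e]
    calc |-(z 0 - P.cenS x 0) + sgOf du * P.c 1| ≤ |-(z 0 - P.cenS x 0)| + |sgOf du * P.c 1| := abs_add_le _ _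
      _ = |z 0 - P.cenS x 0| + P.c 1 := by rw [abs_neg, abs_mul, hσ1, one_mul, abs_of_nonneg hc0]
  have ha0 : 0 ≤ |z 0 - P.cenS x 0| := abs_nonneg _
  obtain ⟨e1, e2⟩ := abs_le.1 he
  have hbw0 : (0 : ℤ) ≤ bw := Nat.cast_nonneg _
  generalize |z 0 - P.cenS x 0| = Az at hz hTle' ha0 ⊢
  generalize (P.c 1 : ℤ) = cc at hkE24 hc0 hTle' ⊢
  generalize T0Y P x du z = T at up hTle' hk' ⊢
  generalize FcA κ Φ t p D g f yT = F₀ at up e1 e2 hk' ⊢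
  generalize (Skelφ.fwdCount T (F₀ + u) u.toNat bw : ℤ) = N at up hk'
  have hku : u * (k : ℤ) ≤ u * N := mul_le_mul_of_nonneg_left hk' (by linarith)
  have hk0 : 0 ≤ u * (k : ℤ) := mul_nonneg (by linarith) (by positivity)
  have hTabs : -|T| ≤ T ∧ T ≤ |T| := ⟨neg_abs_le T, le_abs_self T⟩
  have hT0 : 0 ≤ |T| := abs_nonneg T
  rcases le_max_iff.1 up with h | h
  · constructor <;> nlinarith [hTabs.1, hTabs.2, hTle']
  · constructor <;> nlinarith [hTabs.1, hTabs.2, hTle']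

/-- **`hZfar` at the window of record** (y′-face, any window `≤ 3r₁`, `NegB.small3_le`): `lev + kF₁A + 1 < 20r₁ − small3 1`. [folklore] -/
theorem hZfar_YW (κ : Consts) {V : Type} [DecidableEq V] [Countable V] {G : SimpleGraph V} [G.LocallyFinite] (Φ : PlanarSkeletonFrmQuasi G) (t : V) (p : unitInterval) (D : Skelφ.StepI.DataNS V) (c : ℕ) (mk : ℕ) (g : ℕ) (f : ℕ) (P : PCells2T) (hP : P.toPCells2 = fcellsA κ Φ t p D g f) (x : Site 2) (du : MDir) (hd : du.1 = 1) (j : ℕ) (hj : j < P.K) (z : Site 2) {E : ℕ}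
    (hlev2 : P.lev du x z ≤ P.faceL du.1 j + E) (hEu : (E : ℤ) ≤ u₁A κ Φ t p D g f)
    (hkF1 : kF₁A κ Φ t p D c mk g f ≤ 8 * u₁A κ Φ t p D g f + 1) :
    P.lev du x z + ((fun i : Fin 2 => if i = 0 then kF₀A κ Φ t p D c mk g f else kF₁A κ Φ t p D c mk g f) du.1) + 1 < 20 * (P.r du.1 : ℤ) - ((NegB.BSlot.small3 κ Φ t p D g f du.1 : ℕ) : ℤ) := by
  rw [hd] at hlev2 ⊢
  simp only [show ((1 : Fin 2) = 0) = False from propext ⟨fun h => absurd h (by decide), False.elim⟩, if_false]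
  obtain ⟨-, f2⟩ := faceL_bounds₁ κ Φ t p D g f P hP j hj
  have hr : (P.r 1 : ℤ) = 40 * (Neg.Kq κ : ℤ) * u₁A κ Φ t p D g f := by rw [(cells_of_hP κ Φ t p D g f P hP).1 1]; exact (units_eqA κ Φ t p D g f).2.2.2.1
  have hb : ((NegB.BSlot.small3 κ Φ t p D g f 1 : ℕ) : ℤ) ≤ 3 * (P.r 1 : ℤ) := by
    rw [(cells_of_hP κ Φ t p D g f P hP).1 1]; exact_mod_cast NegB.small3_le κ Φ t p D g f 1
  have hq : (1 : ℤ) ≤ Neg.Kq κ := by exact_mod_cast Neg.one_le_Kq κ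
  have hu : 1 ≤ u₁A κ Φ t p D g f := (units_eqA κ Φ t p D g f).2.2.2.2.2
  have hQu : u₁A κ Φ t p D g f ≤ (Neg.Kq κ : ℤ) * u₁A κ Φ t p D g f := le_mul_of_one_le_left (by linarith) hq
  linarith

end Tan

end KS

end NegB

end PlanarSkeletonFrmQuasi

end Summit.CriticalPhenomena.PercolationContinuityZ3.Theorems.Transplant

end
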